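import Summits.Ventures.PercRepro2.CaseOnePocketMoves
import Summits.Ventures.PercRepro2.CaseOneCore

/-!
# The open core of the rung, with pockets
(blind cell PercRepro2, p1 g27; `CaseOneCore` with the pocket step among the moves)

`InCoreP o a₁ a₂ b v E ends`: `(E, ends)` is residual for `v` and `(E, ends, v)` is NOT reachable by
moves with pockets (`MovesP`: thickenings, pendant steps, pocket steps) from a closed anchor.
**`closedAt_of_coreP`**: the four forms for every weight vector on every such instance give them on
every finite graph. Since every plain move is a move with pockets (`MovesP.of_moves`), the core with
pockets is contained in the core of `CaseOneCore` (`InCore.of_inCoreP`): the pocket reduction shrinks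
the open core of S5 — in a core instance every mark-free pocket at a cut vertex is already a closed
anchor's neighbourhood or the instance is not residual. Own code; standard axioms. -/

namespace Summit.Ventures.PercRepro2

namespace CaseOne

universe u

section CoreP
variable {V : Type*} [Fintype V] [DecidableEq V] (o a₁ a₂ b v : V)

/-- **The core with pockets**: residual for `v`, and not reachable by moves with pockets from a closed
anchor. -/
def InCoreP (E : Type u) [Fintype E] [DecidableEq E] (ends : E → Sym2 V) : Prop :=
  Residual o a₁ a₂ b v E ends ∧
    ¬ ∃ (E₀ : Type u) (_ : Fintype E₀) (_ : DecidableEq E₀) (ends₀ : E₀ → Sym2 V) (v₀ : V),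
      ClosedAnchor o a₁ a₂ b E₀ ends₀ v₀ ∧ MovesP o a₁ a₂ b E₀ ends₀ v₀ E ends v

omit [Fintype V] [DecidableEq V] in
/-- The core with pockets is contained in the core without. -/
theorem InCore.of_inCoreP (E : Type u) [Fintype E] [DecidableEq E] (ends : E → Sym2 V)
    (h : InCoreP o a₁ a₂ b v E ends) : InCore o a₁ a₂ b v E ends := by
  refine ⟨h.1, fun hreach => h.2 ?_⟩
  obtain ⟨E₀, _, _, ends₀, v₀, hanc, hmv⟩ := hreach
  exact ⟨E₀, inferInstance, inferInstance, ends₀, v₀, hanc, MovesP.of_moves hmv⟩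

variable {R : Type*} [Field R] [LinearOrder R] [IsStrictOrderedRing R]

/-- **The reduction to the core with pockets**: the four forms for every weight vector on every core
instance give them on every finite graph. -/
theorem closedAt_of_coreP
    (hcore : ∀ (E' : Type u) [Fintype E'] [DecidableEq E'] (ends' : E' → Sym2 V),
      InCoreP o a₁ a₂ b v E' ends' → ClosedAt R o a₁ a₂ b E' ends' v)
    (E : Type u) [Fintype E] [DecidableEq E] (ends : E → Sym2 V) : ClosedAt R o a₁ a₂ b E ends v := by
  refine closedAt_of_residual (fun E' _ _ ends' hres => ?_) E ends
  by_cases hreach : ∃ (E₀ : Type u) (_ : Fintype E₀) (_ : DecidableEq E₀) (ends₀ : E₀ → Sym2 V)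
      (v₀ : V), ClosedAnchor o a₁ a₂ b E₀ ends₀ v₀ ∧ MovesP o a₁ a₂ b E₀ ends₀ v₀ E' ends' v
  · obtain ⟨E₀, _, _, ends₀, v₀, hanc, hmv⟩ := hreach
    exact closedAt_of_movesP_closedAnchor o a₁ a₂ b hanc hmv
  · exact hcore E' ends' ⟨hres, hreach⟩

/-- The four forms for one weight vector on any finite graph, from the core with pockets. -/
theorem fourForms_of_coreP
    (hcore : ∀ (E' : Type u) [Fintype E'] [DecidableEq E'] (ends' : E' → Sym2 V),
      InCoreP o a₁ a₂ b v E' ends' → ClosedAt R o a₁ a₂ b E' ends' v)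
    {E : Type u} [Fintype E] [DecidableEq E] (ends : E → Sym2 V) (p : E → R) (hp : IsProbVec p) :
    FourForms p ends o a₁ a₂ v b :=
  closedAt_of_coreP o a₁ a₂ b v hcore E ends p hp

end CoreP

end CaseOne

end Summit.Ventures.PercRepro2
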